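import Literature.AlgebraicGeometry.GroupSchemes.TorsorQuotientKernelOnPoints
import Literature.AlgebraicGeometry.RelativeSpec.GeometricQuotientGroupLaw
import Mathlib.AlgebraicGeometry.Morphisms.Finite
import Mathlib.AlgebraicGeometry.Morphisms.Flat
import Mathlib.CategoryTheory.Limits.Constructions.Over.Connected
import Mathlib.CategoryTheory.Monoidal.Cartesian.Mod
import HarnessLib

/-!
# The torsor square of a homomorphism whose kernel (on points) is a given subobject

Topic `AlgebraicGeometry/GroupSchemes`; namespace `Literature.AlgebraicGeometry.GroupSchemes.TorsorSquareOfKernel`.  THEOREMS ONLY (no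
definition, no instance, no notation, no named fact).  Cell `pub/hodgecm-mathlib`, P6b wave C, row Dα of the §D line
(`Cruxes/HLiu418/Lines/F0_P6b_MumfordDualFlat.lean` §D `stub_L4B1uD_mumfordLambdaDescent`: «`1 × π : A × A → A × Â` is an fppf
`{0} × K(L)`-torsor»); dealer desk F0P6b-plan (g14); `--supports stmt-HodgeConjecture-24832`, count-neutral.  HC_CM is proved only modulo the
printed citations (2 remaining named inputs hLiu418 = `stmt-HodgeConjecture-24832`, h413 = `stmt-HodgeConjecture-24833`) until rung 0 closes;
nothing here is about HC.

THE PRINT.  [MumfordAV1970] §12 Thm. 1 (3) (p. 111) «`X` is a `G`-torsor over `Y`: `G × X ≅ X ×_Y X`» and §7 Thm. 4 (p. 72) «`K = ker f`»;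
[GortzWedhorn2020] Definition 4.45 (2) (p. 117) (the kernel of a homomorphism on `T`-valued points: «`f(x) = f(y) ⟺ x y⁻¹ ∈ Ker f`»);
[SGA3I] Exp. V Thm. 4.1 (iv).  In a cartesian monoidal category `C` (for schemes `C = Over S`) let `π : A → B` be a homomorphism of group
objects and `i : Z ⟶ A` a MONOMORPHISM which IS THE KERNEL OF `π` ON `T`-VALUED POINTS —

  `hker : ∀ {T} (u : T ⟶ A), u ≫ π = 1 ↔ ∃ v : T ⟶ Z, v ≫ i = u`

(the fifth conclusion conjunct of the socket §Q `stub_L4B1uQ_quotientByFiniteFlatSubgroup`, the kernel hypothesis of §D).  Then: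

* §1 **`isPullback_act_snd_of_kernel`** — THE TORSOR SQUARE for the LEFT translation `act := (i ▷ A) ≫ μ[A] : Z ⊗ A → A`,
  `(z, a) ↦ i z · a`: the square `act, pr₂ : Z ⊗ A ⇉ A → B` over `(π, π)` is CARTESIAN, `(act, pr₂) : Z ⊗ A ≅ A ×_B A` — the `hsq` token of
  ★ `GroupSchemes/GroupLawDescendsAlongTorsorQuotient`, ★ `GroupSchemes/TorsorQuotientKernelOnPoints` (its CONVERSE: square ⇒ kernel clause) and
  ★ `RelativeSpec/TorsorQuotientGlobal`; and the bridge **`isPullback_unit_of_kernel`** — the points clause makes `Z →(i) A →(π) B ←(η) 𝟙` a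
  CARTESIAN square, so that ★ `GroupSchemes/GroupSchemeKernel` (`kerLift`, …) and the right-translation shear ★
  `GroupSchemeKernel.isPullback_fst_mul_of_isPullback_unit` apply to a kernel given on points.
* §2 **`isPullback_actSnd_snd_of_kernel`** — THE PRODUCT FORM: for any object `X`, `Z` acting on the SECOND factor of `X ⊗ A` by
  `(z, (x, a)) ↦ (x, i z · a)` (spelled with `lift`, no definition), the square over `(X ◁ π, X ◁ π)` is cartesian:
  `Z ⊗ (X ⊗ A) ≅ (X ⊗ A) ×_{X ⊗ B} (X ⊗ A)` — «`1 × π` is a `{e} × Z`-torsor».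
* §3 SCHEMES (`C = Over S`, `Mono i` from `IsClosedImmersion i.left`): `Over.isPullback_act_snd_of_kernel` (the `Over S` square),
  `Over.isPullback_act_snd_left_of_kernel` / `Over.isPullback_actSnd_snd_left_of_kernel` (underlying schemes, `Over.forget` preserves pullbacks),
  and `Over.isFinite_whiskerLeft_left` / `flat_…` / `surjective_…` — `(X ◁ π).left : X ×_S A → X ×_S B` is finite / flat / surjective when
  `π.left` is (base change, ★ `ActionOver.IsGeometricQuotient.isPullback_whiskerLeft_left`).

* §4 (ED. 2) **`isPullback_snd_whiskerLeft_of_kernel`** — the product form for ANY morphism `act' : Z ⊗ (X ⊗ A) → X ⊗ A` with the points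
  formula `(z, (x, a)) ↦ (x, i z · a)`; the two action laws **`actSnd_one`** ∕ **`actSnd_mul`** (for `Z` a group object and `i` a
  homomorphism) and the `ModObj` TERM **`ModObj.ofKernelTranslation i X : ModObj Z (X ⊗ A)`** (an `abbrev` with body, NOT an instance —
  the wave-C seam «α′»: consumers `letI := …`), with `isPullback_smul_snd_of_kernel` ∕ `Over.isPullback_smul_snd_of_kernel`: «`1 × π` is a
  torsor» for `γ[Z, X ⊗ A]` of that term.

No commutativity, no finiteness and no scheme structure enter §1–§2: everything is the universal property read in the groups `A(T) = (T ⟶ A)`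
(Mathlib's scoped `Hom` group of a group object), as in ★ `TorsorQuotientKernelOnPoints` whose lemmas `lift_comp_act`, `comp_act_eq_mul` are
reused BY NAME; the near-twin ★ `GroupSchemeKernelShear` (right translation, kernel as a cartesian square) is not restated.

## References
* [MumfordAV1970] D. Mumford, *Abelian Varieties* (1970), §7 Thm. 4 (p. 72); §12 Thm. 1 (3) (p. 111) and its proof (p. 114); §13 (pp. 125–127).
* [GortzWedhorn2020] U. Görtz, T. Wedhorn, *Algebraic Geometry I*, 2nd ed. (2020), Definition 4.45 (2) (p. 117).
* [SGA3I] M. Demazure, A. Grothendieck (eds.), *SGA 3, Tome I*, Exp. V Thm. 4.1 (iv).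
* [SGA1] A. Grothendieck, M. Raynaud, *SGA 1*, Exp. V §1 (fibre products of `S`-schemes with operators).
-/

set_option autoImplicit false

noncomputable section

universe v u

open CategoryTheory CategoryTheory.Limits MonoidalCategory CartesianMonoidalCategory
open scoped MonObj

namespace Literature.AlgebraicGeometry.GroupSchemes.TorsorSquareOfKernel

open Literature.AlgebraicGeometry.GroupSchemes.TorsorQuotientKernel (lift_comp_act comp_act_eq_mul)

/-! ## §1  The torsor square of the left translation by the kernel -/

section Torsor

variable {C : Type u} [Category.{v} C] [CartesianMonoidalCategory C] {Z A B : C} [GrpObj A] [GrpObj B]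
  (i : Z ⟶ A) (π : A ⟶ B) [IsMonHom π]

omit [GrpObj A] [IsMonHom π] in
/-- **The kernel is killed**: `i ≫ π = 1` (the points clause at `u := i`, `v := 𝟙`). [cite: GortzWedhorn2020, Definition 4.45 (2) (p. 117)] -/
theorem hom_comp_eq_one (hker : ∀ {T : C} (u : T ⟶ A), u ≫ π = 1 ↔ ∃ v : T ⟶ Z, v ≫ i = u) : i ≫ π = 1 :=
  (hker i).2 ⟨𝟙 Z, Category.id_comp i⟩

/-- **The action square commutes**: `act ≫ π = pr₂ ≫ π` for `act = (i ▷ A) ≫ μ` — on points `π (i z · a) = π (i z) · π a = π a`.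
[cite: MumfordAV1970, §12 Thm. 1 (3) (p. 111)] -/
theorem act_comp_eq_snd_comp (hZ : i ≫ π = 1) : ((i ▷ A) ≫ μ[A]) ≫ π = snd Z A ≫ π := by
  rw [← Category.id_comp ((i ▷ A) ≫ μ[A]), comp_act_eq_mul i (𝟙 (Z ⊗ A)), MonObj.mul_comp, Category.assoc, hZ, MonObj.comp_one,
    one_mul, Category.id_comp]

/-- **Two points with the same image differ by a point of the kernel**: `a ≫ π = b ≫ π ⟹ ∃ v : T ⟶ Z, (v ≫ i) · b = a`
(«`f(x) = f(y) ⟺ x y⁻¹ ∈ Ker f`», the direction ⟸ being `act_comp_eq_snd_comp`). [cite: GortzWedhorn2020, Definition 4.45 (2) (p. 117)] -/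
theorem exists_mul_eq_of_comp_eq (hker : ∀ {T : C} (u : T ⟶ A), u ≫ π = 1 ↔ ∃ v : T ⟶ Z, v ≫ i = u) {T : C} (a b : T ⟶ A)
    (h : a ≫ π = b ≫ π) : ∃ v : T ⟶ Z, (v ≫ i) * b = a := by
  have h1 : (a * b⁻¹) ≫ π = 1 := by
    rw [MonObj.mul_comp, GrpObj.inv_comp, h, mul_inv_cancel]
  obtain ⟨v, hv⟩ := (hker (a * b⁻¹)).1 h1
  exact ⟨v, by rw [hv, inv_mul_cancel_right]⟩

/-- **THE TORSOR SQUARE OF A HOMOMORPHISM WITH GIVEN KERNEL** ([MumfordAV1970] §12 Thm. 1 (3) «`G × X ≅ X ×_Y X`»; [SGA3I] V 4.1 (iv)):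
for a homomorphism `π : A → B` of group objects and a monomorphism `i : Z ↪ A` which is the kernel of `π` on `T`-valued points, the square
```
Z ⊗ A --act--> A
  |            |
 pr₂           π
  v            v
  A  ---π--->  B
```
with `act = (i ▷ A) ≫ μ` the left translation is CARTESIAN: `(act, pr₂) : Z ⊗ A ≅ A ×_B A`.  Proof on points: a pair `(a, b)` with
`π a = π b` is hit by `(v, b)` with `i v = a b⁻¹` (`exists_mul_eq_of_comp_eq`), uniquely since `i` is mono.
[cite: MumfordAV1970, §12 Thm. 1 (3) (p. 111) and §7 Thm. 4 (p. 72)] [cite: GortzWedhorn2020, Definition 4.45 (2) (p. 117)] -/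
theorem isPullback_act_snd_of_kernel [Mono i] (hker : ∀ {T : C} (u : T ⟶ A), u ≫ π = 1 ↔ ∃ v : T ⟶ Z, v ≫ i = u) :
    IsPullback ((i ▷ A) ≫ μ[A]) (snd Z A) π π := by
  have hw : ((i ▷ A) ≫ μ[A]) ≫ π = snd Z A ≫ π := act_comp_eq_snd_comp i π (hom_comp_eq_one i π hker)
  refine IsPullback.of_isLimit' ⟨hw⟩ (PullbackCone.IsLimit.mk hw
    (fun s => lift (exists_mul_eq_of_comp_eq i π hker s.fst s.snd s.condition).choose s.snd)
    (fun s => ?_) (fun s => lift_snd _ _) (fun s m hm₁ hm₂ => ?_))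
  · rw [lift_comp_act]
    exact (exists_mul_eq_of_comp_eq i π hker s.fst s.snd s.condition).choose_spec
  · have hv := (exists_mul_eq_of_comp_eq i π hker s.fst s.snd s.condition).choose_spec
    apply CartesianMonoidalCategory.hom_ext
    · rw [lift_fst, ← cancel_mono i]
      have h1 := comp_act_eq_mul i m
      rw [hm₁, hm₂] at h1
      exact mul_right_cancel (h1.symm.trans hv.symm)
    · rw [lift_snd, hm₂]

omit [GrpObj A] [IsMonHom π] in
/-- **THE KERNEL SQUARE from the points clause**: if the monomorphism `i : Z ↪ A` is the kernel of `π` on `T`-valued points, then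
`Z →(i) A →(π) B ←(η) 𝟙` is CARTESIAN — the hypothesis shape of ★ `GroupSchemeKernel.isPullback_fst_mul_of_isPullback_unit` (the right-translation
shear) and of the `kerLift` API, now available from the points clause. [cite: GortzWedhorn2020, Definition 4.45 (2) (p. 117)] -/
theorem isPullback_unit_of_kernel [Mono i] (hker : ∀ {T : C} (u : T ⟶ A), u ≫ π = 1 ↔ ∃ v : T ⟶ Z, v ≫ i = u) :
    IsPullback i (toUnit Z) π η[B] := by
  have hw : i ≫ π = toUnit Z ≫ η[B] := by rw [hom_comp_eq_one i π hker, Hom.one_def]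
  have hex : ∀ s : PullbackCone π η[B], ∃ v : s.pt ⟶ Z, v ≫ i = s.fst := fun s =>
    (hker s.fst).1 (by rw [s.condition, Hom.one_def]; exact congrArg (· ≫ η[B]) (toUnit_unique _ _))
  refine IsPullback.of_isLimit' ⟨hw⟩ (PullbackCone.IsLimit.mk hw (fun s => (hex s).choose)
    (fun s => (hex s).choose_spec) (fun s => toUnit_unique _ _) (fun s m hm₁ _ => ?_))
  rw [← cancel_mono i, hm₁]
  exact (hex s).choose_spec.symm

end Torsor

/-! ## §2  The product form: `Z` acting on the second factor of `X ⊗ A` -/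

section Product

variable {C : Type u} [Category.{v} C] [CartesianMonoidalCategory C] {Z A B : C} [GrpObj A] [GrpObj B]
  (i : Z ⟶ A) (π : A ⟶ B) [IsMonHom π]

omit [GrpObj B] [IsMonHom π] in
/-- The action on the second factor, on points: `lift v c ≫ actSnd = lift (c ≫ fst) ((v ≫ i) * (c ≫ snd))`, i.e. `(v, (x, a)) ↦ (x, i v · a)`.
[cite: SGA1, Exp. V §1] -/
theorem lift_comp_actSnd (X : C) {T : C} (v : T ⟶ Z) (c : T ⟶ X ⊗ A) :
    lift v c ≫ lift (snd Z (X ⊗ A) ≫ fst X A) (lift (fst Z (X ⊗ A)) (snd Z (X ⊗ A) ≫ snd X A) ≫ (i ▷ A) ≫ μ[A]) =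
      lift (c ≫ fst X A) ((v ≫ i) * (c ≫ snd X A)) := by
  apply CartesianMonoidalCategory.hom_ext
  · rw [Category.assoc, lift_fst, lift_fst, lift_snd_assoc]
  · rw [Category.assoc, lift_snd, lift_snd, ← Category.assoc, comp_lift, lift_fst, lift_snd_assoc, lift_comp_act]

omit [GrpObj B] [IsMonHom π] in
/-- A point `w` of `Z ⊗ (X ⊗ A)` acts on the second factor as `w ≫ actSnd = ((w ≫ snd) ≫ fst, ((w ≫ fst) ≫ i) · ((w ≫ snd) ≫ snd))`.
[cite: SGA1, Exp. V §1] -/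
theorem comp_actSnd_eq (X : C) {T : C} (w : T ⟶ Z ⊗ (X ⊗ A)) :
    w ≫ lift (snd Z (X ⊗ A) ≫ fst X A) (lift (fst Z (X ⊗ A)) (snd Z (X ⊗ A) ≫ snd X A) ≫ (i ▷ A) ≫ μ[A]) =
      lift ((w ≫ snd Z (X ⊗ A)) ≫ fst X A) (((w ≫ fst Z (X ⊗ A)) ≫ i) * ((w ≫ snd Z (X ⊗ A)) ≫ snd X A)) := by
  rw [← lift_comp_fst_snd w, lift_comp_actSnd, lift_fst, lift_snd]

/-- **THE TORSOR SQUARE, PRODUCT FORM** («`1 × π : X × A → X × B` is a `{e} × Z`-torsor»; [MumfordAV1970] §13 p. 125 for `A × A → A × Â`):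
with `Z` acting on the second factor of `X ⊗ A` by `(z, (x, a)) ↦ (x, i z · a)`, the square over `(X ◁ π, X ◁ π)` is CARTESIAN,
`Z ⊗ (X ⊗ A) ≅ (X ⊗ A) ×_{X ⊗ B} (X ⊗ A)`. [cite: MumfordAV1970, §12 Thm. 1 (3) (p. 111) and §13 (p. 125)] [cite: SGA1, Exp. V §1] -/
theorem isPullback_actSnd_snd_of_kernel [Mono i] (hker : ∀ {T : C} (u : T ⟶ A), u ≫ π = 1 ↔ ∃ v : T ⟶ Z, v ≫ i = u) (X : C) :
    IsPullback (lift (snd Z (X ⊗ A) ≫ fst X A) (lift (fst Z (X ⊗ A)) (snd Z (X ⊗ A) ≫ snd X A) ≫ (i ▷ A) ≫ μ[A]))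
      (snd Z (X ⊗ A)) (X ◁ π) (X ◁ π) := by
  have hZ : i ≫ π = 1 := hom_comp_eq_one i π hker
  -- the square commutes: both composites are `(x, π a)`
  have hw : lift (snd Z (X ⊗ A) ≫ fst X A) (lift (fst Z (X ⊗ A)) (snd Z (X ⊗ A) ≫ snd X A) ≫ (i ▷ A) ≫ μ[A]) ≫ X ◁ π =
      snd Z (X ⊗ A) ≫ X ◁ π := by
    have hw' : (i ▷ A) ≫ μ[A] ≫ π = snd Z A ≫ π := by
      simpa only [Category.assoc] using act_comp_eq_snd_comp i π hZ
    apply CartesianMonoidalCategory.hom_ext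
    · simp only [Category.assoc, whiskerLeft_fst, lift_fst]
    · simp only [Category.assoc, whiskerLeft_snd, lift_snd_assoc]
      rw [hw', lift_snd_assoc, Category.assoc]
  refine IsPullback.of_isLimit' ⟨hw⟩ (PullbackCone.IsLimit.mk hw
    (fun s => lift (exists_mul_eq_of_comp_eq i π hker (s.fst ≫ snd X A) (s.snd ≫ snd X A)
      (by rw [Category.assoc, Category.assoc, ← whiskerLeft_snd, ← Category.assoc, s.condition, Category.assoc])).choose s.snd)
    (fun s => ?_) (fun s => lift_snd _ _) (fun s m hm₁ hm₂ => ?_))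
  · -- `(v, c₂) ↦ (x₂, i v · a₂) = (x₁, a₁) = c₁`
    have hv := (exists_mul_eq_of_comp_eq i π hker (s.fst ≫ snd X A) (s.snd ≫ snd X A)
      (by rw [Category.assoc, Category.assoc, ← whiskerLeft_snd, ← Category.assoc, s.condition, Category.assoc])).choose_spec
    have hx : s.fst ≫ fst X A = s.snd ≫ fst X A := by
      have h := congrArg (· ≫ fst X B) s.condition
      simpa only [Category.assoc, whiskerLeft_fst] using h
    rw [lift_comp_actSnd, hv, ← hx, lift_comp_fst_snd]
  · have hv := (exists_mul_eq_of_comp_eq i π hker (s.fst ≫ snd X A) (s.snd ≫ snd X A)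
      (by rw [Category.assoc, Category.assoc, ← whiskerLeft_snd, ← Category.assoc, s.condition, Category.assoc])).choose_spec
    apply CartesianMonoidalCategory.hom_ext
    · rw [lift_fst, ← cancel_mono i]
      -- second components of `m ≫ actSnd = c₁`: `((m ≫ fst) ≫ i) * (c₂ ≫ snd) = c₁ ≫ snd`
      have h1 := comp_actSnd_eq i X m
      rw [hm₁, hm₂] at h1
      have h2 := congrArg (· ≫ snd X A) h1
      simp only [lift_snd] at h2
      exact mul_right_cancel (h2.symm.trans hv.symm)
    · rw [lift_snd, hm₂]

end Product

/-! ## §3  Schemes: `C = Over S` -/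

section Scheme

open _root_.AlgebraicGeometry

variable {S : Scheme.{u}} {Z A B : Over S} [GrpObj A] [GrpObj B] (i : Z ⟶ A) (π : A ⟶ B) [IsMonHom π]
  [IsClosedImmersion i.left] (hker : ∀ (T : Over S) (u : T ⟶ A), u ≫ π = 1 ↔ ∃ v : T ⟶ Z, v ≫ i = u)

include hker

/-- **The torsor square in `Over S`** for a homomorphism `π : A → B` of `S`-group schemes whose kernel on `T`-valued points is the closed
subscheme `i : Z ↪ A` (§Q's kernel clause ⇒ the `hsq` token of ★ `GroupLawDescendsAlongTorsorQuotient` / ★ `TorsorQuotientKernelOnPoints` /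
★ `TorsorQuotientGlobal`). [cite: MumfordAV1970, §12 Thm. 1 (3) (p. 111)] [cite: SGA3I, Exp. V Thm. 4.1 (iv)] -/
theorem Over.isPullback_act_snd_of_kernel : IsPullback ((i ▷ A) ≫ μ[A]) (snd Z A) π π :=
  haveI := TorsorQuotientKernel.Over.mono_of_isClosedImmersion_left i
  TorsorSquareOfKernel.isPullback_act_snd_of_kernel i π (fun u => hker _ u)

/-- **The torsor square on underlying schemes**: `IsPullback act.left pr₂.left π.left π.left`, i.e. `Z ×_S A ≅ A ×_B A` as schemes
(`Over.forget` preserves pullbacks). [cite: MumfordAV1970, §12 Thm. 1 (3) (p. 111)] [cite: SGA3I, Exp. V Thm. 4.1 (iv)] -/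
theorem Over.isPullback_act_snd_left_of_kernel : IsPullback ((i ▷ A) ≫ μ[A]).left (snd Z A).left π.left π.left :=
  (Over.isPullback_act_snd_of_kernel i π hker).map (Over.forget S)

omit [GrpObj A] [IsMonHom π] in
/-- **The kernel square in `Over S`** from the points clause: `Z →(i) A →(π) B ←(η) S` is cartesian — the input of ★ `GroupSchemeKernel` /
★ `GroupSchemeKernelShear` for a kernel given on points. [cite: GortzWedhorn2020, Definition 4.45 (2) (p. 117)] -/
theorem Over.isPullback_unit_of_kernel : IsPullback i (toUnit Z) π η[B] :=
  haveI := TorsorQuotientKernel.Over.mono_of_isClosedImmersion_left i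
  TorsorSquareOfKernel.isPullback_unit_of_kernel i π (fun u => hker _ u)

/-- **«`1 × π` is a `{e} × Z`-torsor», in `Over S`**: for any `S`-scheme `X`, the square of `Z` acting on the second factor of `X ×_S A` over
`(X ◁ π, X ◁ π)` is cartesian (§D: `X := A`, `π : A → Â`, `Z := K(L)`). [cite: MumfordAV1970, §13 (p. 125)] [cite: SGA1, Exp. V §1] -/
theorem Over.isPullback_actSnd_snd_of_kernel (X : Over S) :
    IsPullback (lift (snd Z (X ⊗ A) ≫ fst X A) (lift (fst Z (X ⊗ A)) (snd Z (X ⊗ A) ≫ snd X A) ≫ (i ▷ A) ≫ μ[A]))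
      (snd Z (X ⊗ A)) (X ◁ π) (X ◁ π) :=
  haveI := TorsorQuotientKernel.Over.mono_of_isClosedImmersion_left i
  TorsorSquareOfKernel.isPullback_actSnd_snd_of_kernel i π (fun u => hker _ u) X

/-- The product-form torsor square on underlying schemes. [cite: MumfordAV1970, §13 (p. 125)] [cite: SGA1, Exp. V §1] -/
theorem Over.isPullback_actSnd_snd_left_of_kernel (X : Over S) :
    IsPullback (lift (snd Z (X ⊗ A) ≫ fst X A) (lift (fst Z (X ⊗ A)) (snd Z (X ⊗ A) ≫ snd X A) ≫ (i ▷ A) ≫ μ[A])).left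
      (snd Z (X ⊗ A)).left (X ◁ π).left (X ◁ π).left :=
  (Over.isPullback_actSnd_snd_of_kernel i π hker X).map (Over.forget S)

omit hker
omit [GrpObj A] [GrpObj B] [IsMonHom π] [IsClosedImmersion i.left]

/-- `(X ◁ π).left : X ×_S A → X ×_S B` is FINITE when `π.left` is (base change of `π.left` along `pr₂ : X ×_S B → B`, ★
`ActionOver.IsGeometricQuotient.isPullback_whiskerLeft_left`). [cite: SGA1, Exp. V §1] -/
theorem Over.isFinite_whiskerLeft_left [IsFinite π.left] (X : Over S) : IsFinite (X ◁ π).left :=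
  MorphismProperty.of_isPullback (RelativeSpec.ActionOver.IsGeometricQuotient.isPullback_whiskerLeft_left π X) ‹IsFinite π.left›

/-- `(X ◁ π).left` is FLAT when `π.left` is. [cite: SGA1, Exp. V §1] -/
theorem Over.flat_whiskerLeft_left [Flat π.left] (X : Over S) : Flat (X ◁ π).left :=
  MorphismProperty.of_isPullback (RelativeSpec.ActionOver.IsGeometricQuotient.isPullback_whiskerLeft_left π X) ‹Flat π.left›

/-- `(X ◁ π).left` is SURJECTIVE when `π.left` is. [cite: SGA1, Exp. V §1] -/
theorem Over.surjective_whiskerLeft_left [Surjective π.left] (X : Over S) : Surjective (X ◁ π).left :=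
  MorphismProperty.of_isPullback (RelativeSpec.ActionOver.IsGeometricQuotient.isPullback_whiskerLeft_left π X) ‹Surjective π.left›

end Scheme

/-! ## §4 (ED. 2)  The product form for ANY second-factor action with the points formula; the two action laws of `actSnd` and the
`ModObj` term `ModObj.ofKernelTranslation` (SEAM «α′» of the wave-C line: heads bind `[ModObj G X]`, the term is a construction, no instance) -/

section ProductAbstract

variable {C : Type u} [Category.{v} C] [CartesianMonoidalCategory C] {Z A B : C} [GrpObj A] [GrpObj B]
  (i : Z ⟶ A) (π : A ⟶ B) [IsMonHom π]

/-- **THE TORSOR SQUARE, PRODUCT FORM — for ANY action with the second-factor points formula** («`1 × π : X × A → X × B` is a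
`{e} × Z`-torsor»; [MumfordAV1970] §13 p. 125 for `A × A → A × Â`): if `act' : Z ⊗ (X ⊗ A) → X ⊗ A` acts on points by
`(v, (x, a)) ↦ (x, i v · a)` (`hact'` — so `act'` may be ANY spelling of that action: the `lift` term of `isPullback_actSnd_snd_of_kernel`,
the associator∕braiding term, or the `γ` of whatever `ModObj Z (X ⊗ A)` instance a consumer registers), then the square over
`(X ◁ π, X ◁ π)` is CARTESIAN: `Z ⊗ (X ⊗ A) ≅ (X ⊗ A) ×_{X ⊗ B} (X ⊗ A)`. [cite: MumfordAV1970, §12 Thm. 1 (B) (p. 112) and §13 (p. 125)]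
[cite: SGA1, Exp. V §1] -/
theorem isPullback_snd_whiskerLeft_of_kernel [Mono i] (hker : ∀ {T : C} (u : T ⟶ A), u ≫ π = 1 ↔ ∃ v : T ⟶ Z, v ≫ i = u) (X : C)
    (act' : Z ⊗ (X ⊗ A) ⟶ X ⊗ A)
    (hact' : ∀ {T : C} (v : T ⟶ Z) (c : T ⟶ X ⊗ A), lift v c ≫ act' = lift (c ≫ fst X A) ((v ≫ i) * (c ≫ snd X A))) :
    IsPullback act' (snd Z (X ⊗ A)) (X ◁ π) (X ◁ π) := by
  have hZ : i ≫ π = 1 := hom_comp_eq_one i π hker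
  -- the points formula for an arbitrary point `w` of `Z ⊗ (X ⊗ A)`
  have hw_act : ∀ {T : C} (w : T ⟶ Z ⊗ (X ⊗ A)),
      w ≫ act' = lift ((w ≫ snd Z (X ⊗ A)) ≫ fst X A) (((w ≫ fst Z (X ⊗ A)) ≫ i) * ((w ≫ snd Z (X ⊗ A)) ≫ snd X A)) :=
    fun w => by rw [← lift_comp_fst_snd w, hact', lift_fst, lift_snd]
  -- the square commutes: both composites are `(x, π a)`
  have hw : act' ≫ X ◁ π = snd Z (X ⊗ A) ≫ X ◁ π := by
    rw [← Category.id_comp act', hw_act (𝟙 _)]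
    apply CartesianMonoidalCategory.hom_ext
    · simp only [Category.assoc, whiskerLeft_fst, lift_fst, Category.id_comp]
    · simp only [Category.assoc, whiskerLeft_snd, lift_snd_assoc, Category.id_comp]
      rw [MonObj.mul_comp, Category.assoc, hZ, MonObj.comp_one, one_mul, Category.assoc]
  refine IsPullback.of_isLimit' ⟨hw⟩ (PullbackCone.IsLimit.mk hw
    (fun s => lift (exists_mul_eq_of_comp_eq i π hker (s.fst ≫ snd X A) (s.snd ≫ snd X A)
      (by rw [Category.assoc, Category.assoc, ← whiskerLeft_snd, ← Category.assoc, s.condition, Category.assoc])).choose s.snd)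
    (fun s => ?_) (fun s => lift_snd _ _) (fun s m hm₁ hm₂ => ?_))
  · -- `(v, c₂) ↦ (x₂, i v · a₂) = (x₁, a₁) = c₁`
    have hv := (exists_mul_eq_of_comp_eq i π hker (s.fst ≫ snd X A) (s.snd ≫ snd X A)
      (by rw [Category.assoc, Category.assoc, ← whiskerLeft_snd, ← Category.assoc, s.condition, Category.assoc])).choose_spec
    have hx : s.fst ≫ fst X A = s.snd ≫ fst X A := by
      have h := congrArg (· ≫ fst X B) s.condition
      simpa only [Category.assoc, whiskerLeft_fst] using h
    rw [hact', hv, ← hx, lift_comp_fst_snd]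
  · have hv := (exists_mul_eq_of_comp_eq i π hker (s.fst ≫ snd X A) (s.snd ≫ snd X A)
      (by rw [Category.assoc, Category.assoc, ← whiskerLeft_snd, ← Category.assoc, s.condition, Category.assoc])).choose_spec
    apply CartesianMonoidalCategory.hom_ext
    · rw [lift_fst, ← cancel_mono i]
      -- second components of `m ≫ act' = c₁`: `((m ≫ fst) ≫ i) * (c₂ ≫ snd) = c₁ ≫ snd`
      have h1 := hw_act m
      rw [hm₁, hm₂] at h1
      have h2 := congrArg (· ≫ snd X A) h1
      simp only [lift_snd] at h2
      exact mul_right_cancel (h2.symm.trans hv.symm)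
    · rw [lift_snd, hm₂]

omit [GrpObj B] [IsMonHom π] in
/-- **Unit law of the second-factor action**: `(η ▷ (X ⊗ A)) ≫ actSnd = λ_` — on points `(e, (x, a)) ↦ (x, i e · a) = (x, a)` since
`i` is a homomorphism. [cite: SGA1, Exp. V §1] [cite: GortzWedhorn2020, Definition 4.44 (p. 117)] -/
theorem actSnd_one [GrpObj Z] [IsMonHom i] (X : C) :
    (η[Z] ▷ (X ⊗ A)) ≫ lift (snd Z (X ⊗ A) ≫ fst X A) (lift (fst Z (X ⊗ A)) (snd Z (X ⊗ A) ≫ snd X A) ≫ (i ▷ A) ≫ μ[A]) =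
      (λ_ (X ⊗ A)).hom := by
  have h1 : fst (𝟙_ C) (X ⊗ A) ≫ η[A] = 1 := by
    rw [Hom.one_def, toUnit_unique (fst (𝟙_ C) (X ⊗ A)) (toUnit _)]
  apply CartesianMonoidalCategory.hom_ext
  · simp only [Category.assoc, lift_fst, whiskerRight_snd_assoc, leftUnitor_hom]
  · simp only [Category.assoc, lift_snd, leftUnitor_hom]
    rw [lift_comp_act, MonObj.comp_mul, ← Category.assoc, whiskerRight_fst, Category.assoc, IsMonHom.one_hom, h1, one_mul,
      whiskerRight_snd_assoc]

omit [GrpObj B] [IsMonHom π] in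
/-- **Associativity law of the second-factor action**: `(μ ▷ (X ⊗ A)) ≫ actSnd = α_ ≫ (Z ◁ actSnd) ≫ actSnd` — on points
`((z, z′), (x, a)) ↦ (x, i (z z′) · a) = (x, i z · (i z′ · a))`. [cite: SGA1, Exp. V §1] [cite: GortzWedhorn2020, Definition 4.44 (p. 117)] -/
theorem actSnd_mul [GrpObj Z] [IsMonHom i] (X : C) :
    (μ[Z] ▷ (X ⊗ A)) ≫ lift (snd Z (X ⊗ A) ≫ fst X A) (lift (fst Z (X ⊗ A)) (snd Z (X ⊗ A) ≫ snd X A) ≫ (i ▷ A) ≫ μ[A]) =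
      (α_ Z Z (X ⊗ A)).hom ≫ (Z ◁ lift (snd Z (X ⊗ A) ≫ fst X A) (lift (fst Z (X ⊗ A)) (snd Z (X ⊗ A) ≫ snd X A) ≫ (i ▷ A) ≫ μ[A])) ≫
        lift (snd Z (X ⊗ A) ≫ fst X A) (lift (fst Z (X ⊗ A)) (snd Z (X ⊗ A) ≫ snd X A) ≫ (i ▷ A) ≫ μ[A]) := by
  -- `(i ⊗ i) ≫ μ = (pr₁ ≫ i) · (pr₂ ≫ i)` in `A(Z ⊗ Z)`
  have hmul : μ[Z] ≫ i = (fst Z Z ≫ i) * (snd Z Z ≫ i) := by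
    rw [IsMonHom.mul_hom, Hom.mul_def, ← lift_map, lift_fst_snd, Category.id_comp]
  apply CartesianMonoidalCategory.hom_ext
  · simp only [Category.assoc, lift_fst, whiskerRight_snd_assoc, whiskerLeft_snd_assoc, associator_hom_snd_snd_assoc]
  · have hmul' : ∀ {T : C} (f : T ⟶ Z ⊗ Z), f ≫ μ[Z] ≫ i = (f ≫ fst Z Z ≫ i) * (f ≫ snd Z Z ≫ i) := fun f => by
      rw [hmul, MonObj.comp_mul]
    simp only [Category.assoc, lift_snd, lift_comp_act, MonObj.comp_mul, whiskerRight_fst_assoc, whiskerRight_snd_assoc,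
      whiskerLeft_fst_assoc, whiskerLeft_snd_assoc, associator_hom_fst_assoc, associator_hom_snd_fst_assoc,
      associator_hom_snd_snd_assoc, hmul', mul_assoc]

/-- **The `Z`-module structure on `X ⊗ A` by translation on the second factor through the homomorphism `i : Z → A`** — a TERM (a
construction with body — an `abbrev`, NOT an instance; consumers write `letI := ModObj.ofKernelTranslation i X` or pass it explicitly): `smul := actSnd`
(`(z, (x, a)) ↦ (x, i z · a)`), the two laws being `actSnd_one` ∕ `actSnd_mul`.  Its `γ` satisfies the points formula `hact'` of
`isPullback_snd_whiskerLeft_of_kernel` (`lift_comp_actSnd`), so «`1 × π` is a `{e} × Z`-torsor» for this action.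
[cite: SGA1, Exp. V §1] [cite: MumfordAV1970, §13 (p. 125)] -/
abbrev ModObj.ofKernelTranslation [GrpObj Z] [IsMonHom i] (X : C) : ModObj Z (X ⊗ A) where
  smul := lift (snd Z (X ⊗ A) ≫ fst X A) (lift (fst Z (X ⊗ A)) (snd Z (X ⊗ A) ≫ snd X A) ≫ (i ▷ A) ≫ μ[A])
  one_smul := by
    simp only [MonoidalCategory.selfLeftAction_actionHomLeft, MonoidalCategory.selfLeftAction_actionUnitIso]
    exact actSnd_one i X
  mul_smul := by
    simp only [MonoidalCategory.selfLeftAction_actionHomLeft, MonoidalCategory.selfLeftAction_actionHomRight,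
      MonoidalCategory.selfLeftAction_actionAssocIso]
    exact actSnd_mul i X

omit [GrpObj B] [IsMonHom π] in
/-- Unfolding: the action map of `ModObj.ofKernelTranslation i X` IS `actSnd` (definitional). [cite: SGA1, Exp. V §1] -/
@[simp]
theorem ModObj.ofKernelTranslation_smul [GrpObj Z] [IsMonHom i] (X : C) :
    (TorsorSquareOfKernel.ModObj.ofKernelTranslation i X).smul =
      lift (snd Z (X ⊗ A) ≫ fst X A) (lift (fst Z (X ⊗ A)) (snd Z (X ⊗ A) ≫ snd X A) ≫ (i ▷ A) ≫ μ[A]) :=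
  rfl

/-- **«`1 × π` is a torsor» for the `ModObj` term**: with `letI := ModObj.ofKernelTranslation i X`, the square
`IsPullback γ[Z, X ⊗ A] (snd Z (X ⊗ A)) (X ◁ π) (X ◁ π)` holds (= `isPullback_actSnd_snd_of_kernel`). [cite: MumfordAV1970, §13 (p. 125)] -/
theorem isPullback_smul_snd_of_kernel [GrpObj Z] [IsMonHom i] [Mono i]
    (hker : ∀ {T : C} (u : T ⟶ A), u ≫ π = 1 ↔ ∃ v : T ⟶ Z, v ≫ i = u) (X : C) :
    (letI := TorsorSquareOfKernel.ModObj.ofKernelTranslation i X; IsPullback γ[Z, X ⊗ A] (snd Z (X ⊗ A)) (X ◁ π) (X ◁ π)) :=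
  isPullback_actSnd_snd_of_kernel i π hker X

end ProductAbstract

section SchemeAbstract

open _root_.AlgebraicGeometry

variable {S : Scheme.{u}} {Z A B : Over S} [GrpObj A] [GrpObj B] (i : Z ⟶ A) (π : A ⟶ B) [IsMonHom π]
  [IsClosedImmersion i.left] (hker : ∀ (T : Over S) (u : T ⟶ A), u ≫ π = 1 ↔ ∃ v : T ⟶ Z, v ≫ i = u)

include hker

/-- **«`1 × π` is a `{e} × Z`-torsor», in `Over S`, for ANY second-factor action** `act' : Z ⊗ (X ⊗ A) ⟶ X ⊗ A` with the points formula
`(v, (x, a)) ↦ (x, i v · a)` (e.g. the `γ` of a consumer's `ModObj Z (X ⊗ A)` instance): the square over `(X ◁ π, X ◁ π)` is cartesian.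
[cite: MumfordAV1970, §13 (p. 125)] [cite: SGA1, Exp. V §1] -/
theorem Over.isPullback_snd_whiskerLeft_of_kernel (X : Over S) (act' : Z ⊗ (X ⊗ A) ⟶ X ⊗ A)
    (hact' : ∀ {T : Over S} (v : T ⟶ Z) (c : T ⟶ X ⊗ A), lift v c ≫ act' = lift (c ≫ fst X A) ((v ≫ i) * (c ≫ snd X A))) :
    IsPullback act' (snd Z (X ⊗ A)) (X ◁ π) (X ◁ π) :=
  haveI := TorsorQuotientKernel.Over.mono_of_isClosedImmersion_left i
  TorsorSquareOfKernel.isPullback_snd_whiskerLeft_of_kernel i π (fun u => hker _ u) X act' hact'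

/-- … and on underlying schemes: `IsPullback act'.left pr₂.left (X ◁ π).left (X ◁ π).left` — the `hsq` input shape of the wave-C descent rows
(★ `RelativeSpec/TorsorQuotientDescent` / Dγ) at `π := X ◁ π`. [cite: MumfordAV1970, §13 (p. 125)] [cite: SGA1, Exp. V §1] -/
theorem Over.isPullback_snd_whiskerLeft_left_of_kernel (X : Over S) (act' : Z ⊗ (X ⊗ A) ⟶ X ⊗ A)
    (hact' : ∀ {T : Over S} (v : T ⟶ Z) (c : T ⟶ X ⊗ A), lift v c ≫ act' = lift (c ≫ fst X A) ((v ≫ i) * (c ≫ snd X A))) :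
    IsPullback act'.left (snd Z (X ⊗ A)).left (X ◁ π).left (X ◁ π).left :=
  (Over.isPullback_snd_whiskerLeft_of_kernel i π hker X act' hact').map (Over.forget S)

/-- **«`1 × π` is a torsor» for the `ModObj` term, in `Over S`**: with `letI := ModObj.ofKernelTranslation i X` (`Z` an `S`-group scheme,
`i` a homomorphism), `IsPullback γ[Z, X ⊗ A] (snd Z (X ⊗ A)) (X ◁ π) (X ◁ π)` — the `hsq` input of the Dγ rows at `G := Z`, `X := X ⊗ A`,
`π := X ◁ π`, `σ := ModObj.ofKernelTranslation i X`. [cite: MumfordAV1970, §13 (p. 125)] [cite: SGA1, Exp. V §1] -/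
theorem Over.isPullback_smul_snd_of_kernel [GrpObj Z] [IsMonHom i] (X : Over S) :
    (letI := TorsorSquareOfKernel.ModObj.ofKernelTranslation i X; IsPullback γ[Z, X ⊗ A] (snd Z (X ⊗ A)) (X ◁ π) (X ◁ π)) :=
  haveI := TorsorQuotientKernel.Over.mono_of_isClosedImmersion_left i
  TorsorSquareOfKernel.isPullback_smul_snd_of_kernel i π (fun u => hker _ u) X

end SchemeAbstract

end Literature.AlgebraicGeometry.GroupSchemes.TorsorSquareOfKernel

end
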